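import Mathlib
import HarnessLib
import Summits.NavierStokesRegularity.NavierStokesRegularity.Theorems.IsobarTomographyTubeAlternativeStubTwoSidedVorticityRateBackward
import Summits.NavierStokesRegularity.NavierStokesRegularity.Theorems.SqueezeCycleSingularZoomExtraction
import Summits.NavierStokesRegularity.NavierStokesRegularity.Theorems.SqueezeCycleSingularZoomData
import Summits.NavierStokesRegularity.NavierStokesRegularity.Theorems.TypeICertificateLadderTargetTypeIZoomPhysical

/-!
# The two-sided Type-I law for the vorticity maximum — crux stmt-NavierStokesRegularity-11739
# (`IsobarTomography.TubeAlternative`), line `analytic-propagation-local-patch`,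
# stub `stub_twoSidedVorticityRate`

At a Type-I singular time `T` of a maximal classical solution `(u, p)` of the unforced
Navier–Stokes system on `ℝ³ × [0, T)` (`IsMaximalSmoothSolution ν 0 u p T`: classical on `[0, T)`,
no classical extension past `T`), Leray–Hopf from its rapidly decaying datum (`IsLerayHopfOn`,
`HasRapidSpatialDecay (u 0)`) and blowing up at the Type-I rate (`IsTypeIBlowup u T`:
`‖u(t, x)‖ ≤ C₀/√(T − t)` eventually), the vorticity maximum obeys the TWO-SIDED Type-I law
`c/(T − t) ≤ ‖ω(t)‖_∞ ≤ C/(T − t)` for all `t` of a final interval `[t₁, T)`, in the pointwise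
form of the registered signature: some point carries `c/(T − t) ≤ ‖ω(t, x)‖`, and every point has
`‖ω(t, x)‖ ≤ C/(T − t)`. Everything is proved from theorems of the tree; no named fact is assumed.

## Proof

* **Upper bound** (`upper_gradient_rate`, `upper_vorticity_rate`). For `t` close to `T` and a
  point `x`, the viscosity-normalising parabolic zoom `w(s, y) = c u(T + c²ν s, x + cν y)` with
  `c²ν = (T − t)/2` (the zoom kit of the tree's singular Type-I zoom, `SqueezeCycleSingularZoomData`:
  `zoom_continuousOn`, `zoom_isWeaklyDivFree`, `zoom_oseen`, `zoom_norm_le`) is a continuous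
  Oseen-mild field on a final window `(A, 0)`, `A < −3`, with the Type-I bound `(C₀/√ν)/√(−s)`.
  KNSS 2009, Prop. 4.1 in the quantitative window form `exists_norm_iteratedFDeriv_le_of_typeI_Ioo`
  bounds `‖∇w(−2, 0)‖ = c²ν ‖∇u(t, x)‖ = ((T − t)/2) ‖∇u(t, x)‖` by a constant depending on `C₀/√ν`
  only, whence `‖∇u(t, x)‖ ≤ K/(T − t)` and `‖ω(t, x)‖ ≤ ‖curlCLM‖ K/(T − t)`.
* **Backward Liouville** (helper file `IsobarTomographyTubeAlternativeStubTwoSidedVorticityRateBackward`,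
  registered sub-goal `stub_irrotationalSliceVanishes`: `galilean_boost`,
  `curl_eq_zero_of_curl_slice_eq_zero`, `slice_eq_zero_of_curl_slice_eq_zero`). A Type-I ancient
  mild field `W` of the Oseen gauge
  (`IsTypeIAncientMild C W`) with an irrotational slice `W(s₀)`, `s₀ < 0`, has `W(s₀) ≡ 0`: the slice
  is divergence free, curl free and bounded, hence a constant `b` (div–curl Liouville,
  `eq_of_curl_eq_zero_of_isDivFree_of_bounded`); `W` is classical on every window
  (`IsTypeIAncientMild.exists_isClassicalNSSolutionOn_Ioo`), so the Galilean boost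
  `V(t', x) = W(t' + t − 1, x + t' b) − b` (a classical solution, `galilean_boost`) VANISHES at the
  top time `t' = s₀ − t + 1` and has bounded spatial derivatives of orders `≤ 3` (KNSS's class-uniform
  bounds `exists_norm_iteratedFDeriv_le_of_typeI`); Escauriaza–Seregin–Šverák's backward uniqueness
  for the vorticity in the tree's far-field form for classical solutions
  (`IsClassicalNSSolutionOn.curl_eq_zero_of_farField_of_tendsto`, with `R = 0`) makes `W(t)`
  irrotational for every `t < s₀`, hence constant; the time-shifted field `t ↦ W(t + s₀)` is then a
  slice-constant element of the class and vanishes (`IsTypeIAncientMild.eq_zero_of_slice_const`: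
  the gauge fixes the constant, the Type-I decay `C/√(−t) → 0` kills it); continuity gives `W(s₀) ≡ 0`.
* **Lower bound** (`lower_vorticity_rate`). If it failed, there would be times `t_k ↑ T` with
  `(T − t_k) sup|ω(t_k)| ≤ 1/(k+1)`. Zoom at `(T, x_k)`, `x_k` a Leray point of the slice `t_k`
  (`‖u(t_k, x_k)‖ ≥ c_L√ν/√(T − t_k)`, `typeIZoom_leray_point`, which uses the maximality), with
  `c_k²ν = (T − t_k)/2`: the zooms live on windows `(A_k, 0)`, `A_k → −∞`, have
  `‖w_k(−2, 0)‖ ≥ η > 0` and `‖curl w_k(−2, ·)‖ ≤ 1/(2(k+1))`; a subsequence converges in `C¹_loc`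
  to a Type-I ancient mild field `W` (`exists_tendsto_of_typeI_seq_Ioo`, KNSS 2009, Lemma 6.1 with
  Prop. 4.1), whose slice `−2` is irrotational with `‖W(−2, 0)‖ ≥ η` — contradicting the backward
  Liouville theorem.

## References

* G. Koch, N. Nadirashvili, G. Seregin, V. Šverák, *Liouville theorems for the Navier–Stokes
  equations and applications*, Acta Math. 203 (2009) 83–105 = arXiv:0709.3599, Prop. 4.1,
  Lemma 6.1, proof of Thm. 6.2 (pp. 8, 11–13).
* L. Escauriaza, G. Seregin, V. Šverák, *`L_{3,∞}`-solutions of Navier–Stokes equations and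
  backward uniqueness*, Russ. Math. Surveys 58:2 (2003) 211–250, §3 (3.31)–(3.32), Thm. 5.1.
* J. Leray, Acta Math. 63 (1934), §19 (3.8)–(3.9) (the lower rate of the velocity maximum).
-/

set_option linter.dupNamespace false

noncomputable section

namespace Summit.NavierStokesRegularity.NavierStokesRegularity.Theorems.TubeAlternative.AnalyticPropagation

open Set Filter Topology Function MeasureTheory Metric
open scoped RealInnerProductSpace NNReal ENNReal
open Literature.Analysis Literature.Analysis.FluidPDE
open Summit.NavierStokesRegularity.NavierStokesRegularity.Theorems

/-- Physical space `ℝ³` (file-local notation; the registered stub signature is stated with it). -/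
local notation "E3" => EuclideanSpace ℝ (Fin 3)

/-! ### The Type-I rate window -/

/-- **The Type-I rate on a final window.** `IsTypeIBlowup u T` (`‖u(t, x)‖ ≤ C/√(T − t)`
eventually as `t ↑ T`) provides `C ≥ 0` and `0 < δ ≤ T` with `√(T − t)‖u(t, x)‖ ≤ C` for
`T − δ < t < T` (the form consumed by the zoom kit `zoom_norm_le`). [folklore] -/
theorem exists_rate_window {T : ℝ} (hT : 0 < T) {u : ℝ → (EuclideanSpace ℝ (Fin 3)) → (EuclideanSpace ℝ (Fin 3))} (hI : IsTypeIBlowup u T) :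
    ∃ C δ : ℝ, 0 ≤ C ∧ 0 < δ ∧ δ ≤ T ∧
      ∀ t ∈ Ioo (T - δ) T, ∀ x, Real.sqrt (T - t) * ‖u t x‖ ≤ C := by
  obtain ⟨C, hC⟩ := hI
  obtain ⟨T₁, hT₁T, hT₁⟩ := mem_nhdsLT_iff_exists_Ioo_subset.1 hC
  refine ⟨max C 0, min (T - T₁) T, le_max_right _ _, lt_min (sub_pos.2 hT₁T) hT, min_le_right _ _,
    fun t ht x => ?_⟩
  have hδT₁ : min (T - T₁) T ≤ T - T₁ := min_le_left _ _
  have hpos : 0 < Real.sqrt (T - t) := Real.sqrt_pos.2 (sub_pos.2 ht.2)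
  have h1 : ‖u t x‖ ≤ C / Real.sqrt (T - t) := hT₁ ⟨by linarith [ht.1], ht.2⟩ x
  calc Real.sqrt (T - t) * ‖u t x‖ ≤ Real.sqrt (T - t) * (C / Real.sqrt (T - t)) :=
        mul_le_mul_of_nonneg_left h1 hpos.le
    _ = C := by field_simp
    _ ≤ max C 0 := le_max_left _ _

/-! ### The gradient of a zoom at the zoom centre -/

/-- The gradient of the zoomed slice `y ↦ a • u(t', x₀ + γ y)`, `t' = T + β' s`, at `y` is
`(a γ) • ∇u(t')(x₀ + γ y)` (chain rule, for a differentiable slice `u(t')`). [folklore] -/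
theorem fderiv_smul_stPull_slice {a β' γ T : ℝ} {x₀ : (EuclideanSpace ℝ (Fin 3))} {u : ℝ → (EuclideanSpace ℝ (Fin 3)) → (EuclideanSpace ℝ (Fin 3))} {s : ℝ}
    (hd : Differentiable ℝ (u (T + β' * s))) (y : (EuclideanSpace ℝ (Fin 3))) :
    fderiv ℝ ((a • stPull β' γ T x₀ u) s) y = (a * γ) • fderiv ℝ (u (T + β' * s)) (x₀ + γ • y) := by
  have hd' : Differentiable ℝ (stPull β' γ T x₀ u s) := differentiable_stPull_slice hd
  rw [show (a • stPull β' γ T x₀ u) s = fun z => a • stPull β' γ T x₀ u s z from rfl,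
    fderiv_fun_const_smul (hd' y), fderiv_stPull, smul_smul]

/-! ### The upper vorticity rate (parabolic smoothing at the Type-I scale) -/

/-- **Upper Type-I law for the gradient.** For a classical solution on `[0, T)` which is
Leray–Hopf from its rapidly decaying datum and blows up at the Type-I rate, there are `K` and
`t₁ ∈ [0, T)` with `‖∇u(t, x)‖ ≤ K/(T − t)` for all `t ∈ [t₁, T)` and all `x`. Proof: the
viscosity-normalising parabolic zoom `w(s, y) = c u(T + c²ν s, x + cν y)`, `c² = (T − t)/(2ν)`,
centred at `(T, x)` is a continuous Oseen-mild field on a final window `(A, 0)`, `A < −3`, with the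
Type-I bound `(C/√ν)/√(−s)` (`zoom_oseen`, `zoom_norm_le`), so KNSS's quantitative smoothing
(`exists_norm_iteratedFDeriv_le_of_typeI_Ioo`, Prop. 4.1 (4.10)) bounds `‖∇w(−2, 0)‖ = c²ν‖∇u(t, x)‖`
by a constant depending on `C/√ν` only. [cite: KochNadirashviliSereginSverak2009, Prop. 4.1 (4.10) (arXiv:0709.3599 p. 8)] -/
theorem upper_gradient_rate {ν T : ℝ} (hν : 0 < ν) (hT : 0 < T) {u : ℝ → (EuclideanSpace ℝ (Fin 3)) → (EuclideanSpace ℝ (Fin 3))}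
    {p : ℝ → (EuclideanSpace ℝ (Fin 3)) → ℝ} (hsol : IsClassicalNSSolutionOn (Ico 0 T) ν 0 u p)
    (hLH : IsLerayHopfOn T ν 0 (u 0) u) (hdec : HasRapidSpatialDecay (u 0))
    (hI : IsTypeIBlowup u T) :
    ∃ K : ℝ, ∃ t₁ ∈ Ico 0 T, ∀ t ∈ Ico t₁ T, ∀ x, ‖fderiv ℝ (u t) x‖ ≤ K / (T - t) := by
  obtain ⟨C₀, δ, hC₀, hδ, hδT, hrate⟩ := exists_rate_window hT hI
  -- the zoom data `R = ν`, `α = 1`, `β = ν`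
  have hα : (1 : ℝ) = ν / ν := (div_self hν.ne').symm
  have hβ : ν = ν ^ 2 / ν := by field_simp
  -- the window constant
  obtain ⟨K, hK⟩ := exists_norm_iteratedFDeriv_le_of_typeI_Ioo (1 * C₀ / Real.sqrt ν) 1
    (a := -3) (b := -1) (δ := 1) (by norm_num) (by norm_num) one_pos
  refine ⟨2 * K, T - δ / 2, ⟨by linarith, by linarith⟩, fun t ht x₀ => ?_⟩
  have hTt : 0 < T - t := sub_pos.2 ht.2
  have hTtδ : T - t ≤ δ / 2 := by linarith [ht.1]
  -- the scale `c`, `c² = (T - t)/(2ν)`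
  set c : ℝ := Real.sqrt ((T - t) / (2 * ν)) with hc
  have hc2 : c ^ 2 = (T - t) / (2 * ν) := Real.sq_sqrt (by positivity)
  have hcpos : 0 < c := Real.sqrt_pos.2 (by positivity)
  have hcν : c ^ 2 * ν = (T - t) / 2 := by rw [hc2]; field_simp
  -- the zoom and its window
  set w : ℝ → (EuclideanSpace ℝ (Fin 3)) → (EuclideanSpace ℝ (Fin 3)) := (c * 1) • stPull (c ^ 2 * ν) (c * ν) T x₀ u with hw
  set A : ℝ := -(δ / (c ^ 2 * ν)) with hA
  have hA3 : A < -3 := by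
    rw [hA, hcν, neg_lt_neg_iff, lt_div_iff₀ (by positivity)]
    linarith
  have hcw : ContinuousOn (uncurry w) (Ioo A 0 ×ˢ univ) :=
    zoom_continuousOn hν hsol hν hα hβ hcpos hδT
  have hdivw : ∀ s ∈ Ioo A 0, IsWeaklyDivFree (w s) := fun s hs =>
    zoom_isWeaklyDivFree hν hsol hν hα hβ hcpos hδT hs
  have hmildw : ∀ s s' : ℝ, A < s → s < s' → s' < 0 → ∀ y,
      w s' y = UnboundedOperators.heatExtension (w s) (s' - s) y - oseenDuhamel 1 s w w s' y :=
    fun s s' hs hss' hs' y => zoom_oseen hν hT hsol hLH hdec hν hα hβ hcpos hδT hs hss' hs' y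
  have hIw : ∀ s ∈ Ioo A 0, ∀ y, ‖w s y‖ ≤ (1 * C₀ / Real.sqrt ν) / Real.sqrt (-s) :=
    fun s hs y => zoom_norm_le hν hα hβ hν hcpos hδT hrate hs y
  -- the smoothing bound at `(-2, 0)`
  have hmem : (-2 : ℝ) ∈ Ico (-3 + 1 : ℝ) (-1) := ⟨by norm_num, by norm_num⟩
  have hbound := hK hA3 hcw hdivw hmildw hIw (-2) hmem 0
  rw [norm_iteratedFDeriv_one] at hbound
  -- unzoom: `∇w(-2)(0) = (c²ν) • ∇u(t)(x₀)`
  have htime : T + c ^ 2 * ν * (-2) = t := by rw [hcν]; ring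
  have ht0 : 0 ≤ t := by linarith [ht.1]
  have hdu : Differentiable ℝ (u (T + c ^ 2 * ν * (-2))) := by
    rw [htime]; exact (hsol.contDiff_velocity ⟨ht0, ht.2⟩).differentiable (by simp)
  have hgrad : fderiv ℝ (w (-2)) 0 = (c * 1 * (c * ν)) • fderiv ℝ (u t) x₀ := by
    rw [hw, fderiv_smul_stPull_slice hdu 0, smul_zero, add_zero, htime]
  rw [hgrad, norm_smul, Real.norm_eq_abs, abs_of_pos (by positivity),
    show c * 1 * (c * ν) = (T - t) / 2 by rw [← hcν]; ring] at hbound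
  -- conclude
  rw [le_div_iff₀ hTt]
  have : (T - t) / 2 * ‖fderiv ℝ (u t) x₀‖ ≤ K := hbound
  linarith

/-- **Upper Type-I law for the vorticity**: `‖ω(t, x)‖ ≤ C/(T − t)` near `T`
(`upper_gradient_rate` and `‖curl v x‖ ≤ ‖curlCLM‖ ‖∇v(x)‖`). [cite: KochNadirashviliSereginSverak2009, Prop. 4.1 (4.10) (arXiv:0709.3599 p. 8)] -/
theorem upper_vorticity_rate {ν T : ℝ} (hν : 0 < ν) (hT : 0 < T) {u : ℝ → (EuclideanSpace ℝ (Fin 3)) → (EuclideanSpace ℝ (Fin 3))}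
    {p : ℝ → (EuclideanSpace ℝ (Fin 3)) → ℝ} (hsol : IsClassicalNSSolutionOn (Ico 0 T) ν 0 u p)
    (hLH : IsLerayHopfOn T ν 0 (u 0) u) (hdec : HasRapidSpatialDecay (u 0))
    (hI : IsTypeIBlowup u T) :
    ∃ C : ℝ, ∃ t₁ ∈ Ico 0 T, ∀ t ∈ Ico t₁ T, ∀ x, ‖curl (u t) x‖ ≤ C / (T - t) := by
  obtain ⟨K, t₁, ht₁, hK⟩ := upper_gradient_rate hν hT hsol hLH hdec hI
  refine ⟨‖curlCLM‖ * K, t₁, ht₁, fun t ht x => ?_⟩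
  have hTt : 0 < T - t := sub_pos.2 ht.2
  calc ‖curl (u t) x‖ ≤ ‖curlCLM‖ * ‖fderiv ℝ (u t) x‖ := norm_curl_le _ _
    _ ≤ ‖curlCLM‖ * (K / (T - t)) :=
        mul_le_mul_of_nonneg_left (hK t ht x) (ContinuousLinearMap.opNorm_nonneg _)
    _ = ‖curlCLM‖ * K / (T - t) := by ring

/-! ### The lower vorticity rate (zoom at bad times + backward Liouville) -/

section LowerRate

/-- The vorticity of a zoomed slice: `curl (a • u(t', x₀ + γ ·))(y) = (a γ) • (curl u(t'))(x₀ + γ y)`. [folklore] -/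
theorem curl_smul_stPull_slice {a β' γ T : ℝ} {x₀ : (EuclideanSpace ℝ (Fin 3))} {u : ℝ → (EuclideanSpace ℝ (Fin 3)) → (EuclideanSpace ℝ (Fin 3))} {s : ℝ}
    (hd : Differentiable ℝ (u (T + β' * s))) (y : (EuclideanSpace ℝ (Fin 3))) :
    curl ((a • stPull β' γ T x₀ u) s) y = (a * γ) • curl (u (T + β' * s)) (x₀ + γ • y) := by
  rw [curl_eq_curlCLM, curl_eq_curlCLM, fderiv_smul_stPull_slice hd y, map_smul]

/-- **Lower Type-I law for the vorticity maximum.** For a MAXIMAL classical solution on `[0, T)`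
(no classical extension past `T`), Leray–Hopf from its rapidly decaying datum, blowing up at the
Type-I rate, there are `c > 0` and `t₁ ∈ [0, T)` such that every slice `t ∈ [t₁, T)` has a point
with `c/(T − t) ≤ ‖ω(t, x)‖`. Proof by contradiction: otherwise there are times `t_k ↑ T` with
`(T − t_k) sup|ω(t_k)| ≤ 1/(k+1)`; zoom parabolically at `(T, x_k)`, `x_k` a Leray point of the
slice `t_k` (`‖u(t_k, x_k)‖ ≥ c_L√ν/√(T − t_k)`, `typeIZoom_leray_point`), with `c_k²ν = (T − t_k)/2`,
so that the slice `t_k` sits at zoom time `−2`: the zooms are continuous Type-I Oseen-mild fields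
on windows `(A_k, 0)`, `A_k → −∞` (`zoom_oseen`, `zoom_norm_le`), with `‖w_k(−2, 0)‖ ≥ η > 0` and
`‖curl w_k(−2, ·)‖ ≤ 1/(2(k+1))`; a subsequence converges in `C¹_loc` to a Type-I ancient mild
field `W` (`exists_tendsto_of_typeI_seq_Ioo`, KNSS 2009 Lemma 6.1 with Prop. 4.1), whose slice
`−2` is irrotational yet has `‖W(−2, 0)‖ ≥ η` — contradicting `slice_eq_zero_of_curl_slice_eq_zero`.
[cite: KochNadirashviliSereginSverak2009, Lemma 6.1 and proof of Thm 6.2 (arXiv:0709.3599 pp. 11–13)] -/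
theorem lower_vorticity_rate {ν T : ℝ} (hν : 0 < ν) (hT : 0 < T) {u : ℝ → (EuclideanSpace ℝ (Fin 3)) → (EuclideanSpace ℝ (Fin 3))}
    {p : ℝ → (EuclideanSpace ℝ (Fin 3)) → ℝ} (hmax : IsMaximalSmoothSolution ν 0 u p T)
    (hLH : IsLerayHopfOn T ν 0 (u 0) u) (hdec : HasRapidSpatialDecay (u 0))
    (hI : IsTypeIBlowup u T) :
    ∃ c : ℝ, 0 < c ∧ ∃ t₁ ∈ Ico 0 T, ∀ t ∈ Ico t₁ T, ∃ x, c / (T - t) ≤ ‖curl (u t) x‖ := by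
  have hsol := hmax.1
  have hext := hmax.2
  obtain ⟨cL, hcL, hLer⟩ := typeIZoom_leray_point
  obtain ⟨C₀, δ, hC₀, hδ, hδT, hrate⟩ := exists_rate_window hT hI
  by_contra hneg
  push Not at hneg
  -- ## (1) bad times `t_k ↑ T` and Leray points `x_k`
  have hstart : ∀ k : ℕ, T - δ / ((k : ℝ) + 2) ∈ Ico 0 T := fun k => by
    have h1 : δ / ((k : ℝ) + 2) ≤ δ / 2 :=
      div_le_div_of_nonneg_left hδ.le (by norm_num) (by linarith [(Nat.cast_nonneg k : (0 : ℝ) ≤ k)])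
    have h2 : 0 < δ / ((k : ℝ) + 2) := by positivity
    exact ⟨by linarith, by linarith⟩
  choose tk htk hsmall using fun k : ℕ =>
    hneg (1 / ((k : ℝ) + 1)) (by positivity) (T - δ / ((k : ℝ) + 2)) (hstart k)
  have htkI : ∀ k, tk k ∈ Ico 0 T := fun k => ⟨(hstart k).1.trans (htk k).1, (htk k).2⟩
  have hTtk : ∀ k, 0 < T - tk k := fun k => sub_pos.2 (htk k).2
  have hTtkδ : ∀ k, T - tk k ≤ δ / ((k : ℝ) + 2) := fun k => by linarith [(htk k).1]
  choose xk hxk using fun k => hLer hν hT hsol hLH hdec hext (tk k) (htkI k)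
  -- ## (2) the zooms at `(T, x_k)` with `c_k² ν = (T - t_k)/2`
  have hα : (1 : ℝ) = ν / ν := (div_self hν.ne').symm
  have hβ : ν = ν ^ 2 / ν := by field_simp
  set c : ℕ → ℝ := fun k => Real.sqrt ((T - tk k) / (2 * ν)) with hc
  have hc2 : ∀ k, c k ^ 2 = (T - tk k) / (2 * ν) := fun k =>
    Real.sq_sqrt (div_nonneg (hTtk k).le (by positivity))
  have hcpos : ∀ k, 0 < c k := fun k => Real.sqrt_pos.2 (by have := hTtk k; positivity)
  have hcν : ∀ k, c k ^ 2 * ν = (T - tk k) / 2 := fun k => by rw [hc2]; field_simp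
  set w : ℕ → ℝ → (EuclideanSpace ℝ (Fin 3)) → (EuclideanSpace ℝ (Fin 3)) := fun k => (c k * 1) • stPull (c k ^ 2 * ν) (c k * ν) T (xk k) u with hw
  set A : ℕ → ℝ := fun k => -(δ / (c k ^ 2 * ν)) with hA
  have hAle : ∀ k, A k ≤ -(2 * ((k : ℝ) + 2)) := fun k => by
    simp only [hA]
    rw [hcν, neg_le_neg_iff, le_div_iff₀ (by have := hTtk k; positivity)]
    have h := hTtkδ k
    rw [le_div_iff₀ (by positivity)] at h
    nlinarith
  have hAlim : Tendsto A atTop atBot := by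
    have h1 : Tendsto (fun k : ℕ => (k : ℝ) + 2) atTop atTop :=
      tendsto_atTop_add_const_right _ _ tendsto_natCast_atTop_atTop
    have h2 : Tendsto (fun k : ℕ => -(2 * ((k : ℝ) + 2))) atTop atBot :=
      tendsto_neg_atTop_atBot.comp (h1.const_mul_atTop two_pos)
    exact tendsto_atBot_mono hAle h2
  have hA2 : ∀ k, (-2 : ℝ) ∈ Ioo (A k) 0 := fun k =>
    ⟨(hAle k).trans_lt (by linarith [(Nat.cast_nonneg k : (0 : ℝ) ≤ k)]), by norm_num⟩
  -- per-`k` facts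
  have hcw : ∀ k, ContinuousOn (uncurry (w k)) (Ioo (A k) 0 ×ˢ univ) := fun k =>
    zoom_continuousOn hν hsol hν hα hβ (hcpos k) hδT
  have hdivw : ∀ k, ∀ s ∈ Ioo (A k) 0, IsWeaklyDivFree (w k s) := fun k s hs =>
    zoom_isWeaklyDivFree hν hsol hν hα hβ (hcpos k) hδT hs
  have hmildw : ∀ k, ∀ s s' : ℝ, A k < s → s < s' → s' < 0 → ∀ y,
      w k s' y = UnboundedOperators.heatExtension (w k s) (s' - s) y -
        oseenDuhamel 1 s (w k) (w k) s' y :=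
    fun k s s' hs hss' hs' y => zoom_oseen hν hT hsol hLH hdec hν hα hβ (hcpos k) hδT hs hss' hs' y
  set C₁ : ℝ := 1 * C₀ / Real.sqrt ν with hC₁
  have hIw : ∀ k, ∀ s ∈ Ioo (A k) 0, ∀ y, ‖w k s y‖ ≤ C₁ / Real.sqrt (-s) :=
    fun k s hs y => zoom_norm_le hν hα hβ hν (hcpos k) hδT hrate hs y
  -- ## (3) the slice `-2` of the zooms: large velocity at the origin, small vorticity
  have htime : ∀ k, T + c k ^ 2 * ν * (-2) = tk k := fun k => by rw [hcν]; ring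
  have hdu : ∀ k, Differentiable ℝ (u (T + c k ^ 2 * ν * (-2))) := fun k => by
    rw [htime]; exact (hsol.contDiff_velocity (htkI k)).differentiable (by simp)
  set η : ℝ := Real.sqrt (1 / (2 * ν)) * (cL * Real.sqrt ν) with hη
  have hηpos : 0 < η := by positivity
  have hbig : ∀ k, η ≤ ‖w k (-2) 0‖ := by
    intro k
    have hsq : 0 < Real.sqrt (T - tk k) := Real.sqrt_pos.2 (hTtk k)
    have hck : c k = Real.sqrt (T - tk k) * Real.sqrt (1 / (2 * ν)) := by
      simp only [hc]
      rw [← Real.sqrt_mul (hTtk k).le]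
      congr 1
      field_simp
    have e : w k (-2) 0 = (c k * 1) • u (tk k) (xk k) := by
      show (c k * 1) • u (T + c k ^ 2 * ν * (-2)) (xk k + (c k * ν) • (0 : (EuclideanSpace ℝ (Fin 3)))) = _
      rw [htime, smul_zero, add_zero]
    rw [e, norm_smul, Real.norm_eq_abs, abs_of_pos (by have := hcpos k; positivity), mul_one]
    calc η = c k * (cL * Real.sqrt ν / Real.sqrt (T - tk k)) := by
          rw [hck, hη]; field_simp
      _ ≤ c k * ‖u (tk k) (xk k)‖ := mul_le_mul_of_nonneg_left (hxk k) (hcpos k).le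
  have hsmallw : ∀ k, ∀ y, ‖curl (w k (-2)) y‖ ≤ 1 / (2 * ((k : ℝ) + 1)) := by
    intro k y
    rw [hw, curl_smul_stPull_slice (hdu k) y, norm_smul, Real.norm_eq_abs,
      abs_of_pos (by have := hcpos k; positivity), show c k * 1 * (c k * ν) = (T - tk k) / 2 by
        rw [← hcν]; ring, htime]
    have h := (hsmall k (xk k + (c k * ν) • y)).le
    calc (T - tk k) / 2 * ‖curl (u (tk k)) (xk k + (c k * ν) • y)‖
        ≤ (T - tk k) / 2 * (1 / ((k : ℝ) + 1) / (T - tk k)) :=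
          mul_le_mul_of_nonneg_left h (by have := hTtk k; positivity)
      _ = 1 / (2 * ((k : ℝ) + 1)) := by
          have := (hTtk k).ne'
          field_simp
  -- ## (4) the `C¹_loc` limit
  obtain ⟨φ, hφ, W, hWclass, hpt, hptG, -, -⟩ :=
    exists_tendsto_of_typeI_seq_Ioo C₁ hAlim hcw hdivw hmildw hIw
  -- the limit slice `-2` is irrotational ...
  have hcurlW : ∀ y, curl (W (-2)) y = 0 := by
    intro y
    have h1 : Tendsto (fun j => curl (w (φ j) (-2)) y) atTop (𝓝 (curl (W (-2)) y)) := by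
      have h := hptG (-2) (by norm_num) y
      simp only [curl_eq_curlCLM]
      exact (curlCLM.continuous.tendsto _).comp h
    have h2 : Tendsto (fun j => curl (w (φ j) (-2)) y) atTop (𝓝 0) := by
      rw [tendsto_zero_iff_norm_tendsto_zero]
      have hb : Tendsto (fun j : ℕ => 1 / (2 * ((j : ℝ) + 1))) atTop (𝓝 0) := by
        have h3 : Tendsto (fun j : ℕ => 2 * ((j : ℝ) + 1)) atTop atTop :=
          (tendsto_atTop_add_const_right _ _ tendsto_natCast_atTop_atTop).const_mul_atTop two_pos
        exact tendsto_const_nhds.div_atTop h3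
      refine squeeze_zero (fun j => norm_nonneg _) (fun j => ?_) hb
      refine (hsmallw (φ j) y).trans ?_
      have hj : (j : ℝ) ≤ (φ j : ℝ) := by exact_mod_cast hφ.id_le j
      exact div_le_div_of_nonneg_left zero_le_one (by positivity) (by linarith)
    exact tendsto_nhds_unique h1 h2
  -- ... yet non-zero at the origin
  have hWbig : η ≤ ‖W (-2) 0‖ :=
    ge_of_tendsto' ((hpt (-2) (by norm_num) 0).norm) fun j => hbig (φ j)
  have hWzero : W (-2) 0 = 0 := slice_eq_zero_of_curl_slice_eq_zero hWclass (by norm_num) hcurlW 0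
  rw [hWzero, norm_zero] at hWbig
  linarith

end LowerRate

/-! ### The registered stub -/

/-- **Stub `stub_twoSidedVorticityRate` (line `analytic-propagation-local-patch` of crux
`IsobarTomography.TubeAlternative`).** At a Type-I singular time of a maximal Leray–Hopf
classical solution from a rapidly decaying datum the vorticity maximum obeys a TWO-SIDED Type-I
law `c/(T−t) ≤ ‖ω(t)‖_∞ ≤ C/(T−t)` for `t` near `T`: the upper bound by KNSS's parabolic
smoothing at the Type-I scale (`upper_vorticity_rate`), the lower bound by the zoom at bad times,
the `C¹_loc` compactness of Type-I Oseen-mild fields, and backward uniqueness for the vorticity of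
the Galilean-boosted limit (`lower_vorticity_rate`). Registered signature of the planner, verbatim.
[cite: KochNadirashviliSereginSverak2009, Prop. 4.1, Lemma 6.1, proof of Thm 6.2 (arXiv:0709.3599 pp. 8, 11–13)]
[cite: EscauriazaSereginSverak2003, Thm. 5.1] -/
theorem stub_twoSidedVorticityRate :
    ∀ (ν T : ℝ), 0 < ν → 0 < T → ∀ (u : ℝ → E3 → E3) (p : ℝ → E3 → ℝ),
    IsMaximalSmoothSolution ν 0 u p T → IsLerayHopfOn T ν 0 (u 0) u →
    HasRapidSpatialDecay (u 0) → IsTypeIBlowup u T →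
    ∃ c C : ℝ, 0 < c ∧ ∃ t₁ ∈ Set.Ico 0 T, ∀ t ∈ Set.Ico t₁ T,
      (∃ x : E3, c / (T - t) ≤ ‖curl (u t) x‖) ∧ ∀ x : E3, ‖curl (u t) x‖ ≤ C / (T - t) := by
  intro ν T hν hT u p hmax hLH hdec hI
  obtain ⟨C, t₁, ht₁, hup⟩ := upper_vorticity_rate hν hT hmax.1 hLH hdec hI
  obtain ⟨c, hc, t₂, ht₂, hlow⟩ := lower_vorticity_rate hν hT hmax hLH hdec hI
  refine ⟨c, C, hc, max t₁ t₂, ⟨ht₁.1.trans (le_max_left _ _), max_lt ht₁.2 ht₂.2⟩, fun t ht => ⟨?_, ?_⟩⟩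
  · exact hlow t ⟨(le_max_right _ _).trans ht.1, ht.2⟩
  · exact hup t ⟨(le_max_left _ _).trans ht.1, ht.2⟩

end Summit.NavierStokesRegularity.NavierStokesRegularity.Theorems.TubeAlternative.AnalyticPropagation

end
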